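import Mathlib.Algebra.Order.Floor.Semiring
import Mathlib.Data.NNReal.Basic
import Literature.AlgebraicGeometry.Frobenioids.RealificationRPow
import HarnessLib

/-!
# Frobenioids I, Def. 2.4 (i)/(ii): `ℝ_{≥0}`-valued homomorphisms on a realification are `ℝ_{≥0}`-LINEAR

Mochizuki, *The geometry of Frobenioids I*, Kyushu J. Math. **62** (2008), Def. 2.4 (i)–(ii) p. 48 ("`(M^rlf)^gp` …
is an `ℝ`-vector space"; "if `Λ` supports `M`, then `Λ_{>0}` acts naturally on `M`") and its use in Thm. 6.4 (ii)
p. 114 (the degree `deg(Ψ^rlf) ∈ ℝ_{>0}`: real-valued degree maps on `Φ^rlf` are compared `ℝ`-linearly)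
[cite: MochizukiFrdI2008, Def. 2.4(ii) p.48] [cite: MochizukiFrdI2008, Thm. 6.4 (ii) p.114].

PROOF-ONLY.  The elementary real-analysis input that makes "`ℝ`-linear" meaningful for monoid homomorphisms
into `ℝ_{≥0}`:
* `nnreal_map_eq_mul_of_map_add` — an ADDITIVE map `g : ℝ_{≥0} → ℝ_{≥0}` is linear, `g r = r · g 1`
  (additive ⇒ monotone and `ℚ_{≥0}`-homogeneous; squeeze between `⌊nr⌋/n` and `(⌊nr⌋+1)/n`);
* `IsPerfFactorial.Rlf.hom_nnreal_rpow` — consequently EVERY homomorphism `φ : M^rlf → ℝ_{≥0}` (e.g. a degree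
  map) is compatible with the real powers of `RealificationRPow.lean`: `φ(a^r) = r · φ(a)` (additively), since
  `r ↦ φ(a^r)` is additive in `r`.
Seat abc-iut-L1-d2 (cell abc-iut).
-/

noncomputable section

namespace Literature.AlgebraicGeometry.Frobenioids

open Function NNReal

universe u

/-- **An additive self-map of `ℝ_{≥0}` is linear**: `g (a + b) = g a + g b` for all `a, b` forces
`g r = r · g 1` — the real-analysis fact behind "`(M^rlf)^gp` is an `ℝ`-vector space" / "`ℝ_{>0}` acts
naturally" (Def. 2.4 (i)(ii)): additive maps between such objects are automatically `ℝ`-linear.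
[cite: MochizukiFrdI2008, Def. 2.4(ii) p.48] -/
theorem nnreal_map_eq_mul_of_map_add (g : ℝ≥0 → ℝ≥0) (hadd : ∀ a b, g (a + b) = g a + g b) (r : ℝ≥0) :
    g r = r * g 1 := by
  have g0 : g 0 = 0 := by
    have h := hadd 0 0
    rw [add_zero] at h
    exact add_eq_left.mp h.symm
  have mono : Monotone g := fun a b hab => by
    obtain ⟨d, rfl⟩ := exists_add_of_le hab
    rw [hadd]
    exact le_self_add
  have gnat : ∀ (n : ℕ) (a : ℝ≥0), g (n * a) = n * g a := by
    intro n a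
    induction n with
    | zero => rw [Nat.cast_zero, zero_mul, zero_mul, g0]
    | succ n ih => rw [Nat.cast_succ, add_mul, one_mul, hadd, ih, add_mul, one_mul]
  have gdiv : ∀ (n : ℕ), 0 < n → ∀ a, g (a / n) = g a / n := by
    intro n hn a
    have hn' : (n : ℝ≥0) ≠ 0 := by exact_mod_cast hn.ne'
    rw [eq_div_iff hn', mul_comm, ← gnat, mul_div_cancel₀ _ hn']
  have hq : ∀ (m n : ℕ), 0 < n → g ((m : ℝ≥0) / n) = (m : ℝ≥0) / n * g 1 := by
    intro m n hn
    have hm : g (m : ℝ≥0) = m * g 1 := by rw [← gnat m 1, mul_one]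
    rw [gdiv n hn, hm, div_mul_eq_mul_div]
  set c := g 1 with hc
  -- squeeze: for `n > 0`, `m = ⌊n r⌋`: `m/n ≤ r < (m+1)/n`
  have bounds : ∀ n : ℕ, 0 < n →
      g r ≤ r * c + c / n ∧ r * c ≤ g r + c / n := by
    intro n hn
    have hnpos : (0 : ℝ≥0) < n := by exact_mod_cast hn
    set m := ⌊(n : ℝ≥0) * r⌋₊ with hm
    have hm_le : ((m : ℕ) : ℝ≥0) / n ≤ r := by
      rw [div_le_iff₀ hnpos, mul_comm]
      exact Nat.floor_le (by simp)
    have hr_lt : r ≤ ((m + 1 : ℕ) : ℝ≥0) / n := by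
      rw [le_div_iff₀ hnpos, mul_comm]
      exact_mod_cast (Nat.lt_floor_add_one ((n : ℝ≥0) * r)).le
    have h1 : ((m + 1 : ℕ) : ℝ≥0) / n * c = (m : ℝ≥0) / n * c + c / n := by
      rw [Nat.cast_succ, add_div, add_mul, div_mul_eq_mul_div (1 : ℝ≥0), one_mul]
    constructor
    · calc g r ≤ g (((m + 1 : ℕ) : ℝ≥0) / n) := mono hr_lt
        _ = (m : ℝ≥0) / n * c + c / n := by rw [hq _ _ hn, h1]
        _ ≤ r * c + c / n := by gcongr
    · calc r * c ≤ ((m + 1 : ℕ) : ℝ≥0) / n * c := by gcongr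
        _ = (m : ℝ≥0) / n * c + c / n := h1
        _ ≤ g r + c / n := by
          gcongr ?_ + _
          rw [← hq _ _ hn]
          exact mono hm_le
  -- let `n → ∞`
  have small : ∀ ε : ℝ≥0, 0 < ε → ∃ n : ℕ, 0 < n ∧ c / n ≤ ε := by
    intro ε hε
    obtain ⟨n, hn⟩ := exists_nat_gt (c / ε)
    have hnpos : (0 : ℝ≥0) < n := lt_of_le_of_lt (by simp) hn
    refine ⟨n, by exact_mod_cast hnpos, ?_⟩
    rw [div_le_iff₀ hnpos]
    rw [div_lt_iff₀ hε] at hn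
    rw [mul_comm]
    exact hn.le
  apply le_antisymm
  · apply le_of_forall_pos_le_add
    intro ε hε
    obtain ⟨n, hn, hcn⟩ := small ε hε
    exact ((bounds n hn).1).trans (by gcongr)
  · apply le_of_forall_pos_le_add
    intro ε hε
    obtain ⟨n, hn, hcn⟩ := small ε hε
    exact ((bounds n hn).2).trans (by gcongr)

namespace IsPerfFactorial.Rlf

variable {M : Type u} [CommMonoid M] (h : IsPerfFactorial M)

/-- **Homomorphisms `M^rlf → ℝ_{≥0}` are `ℝ_{≥0}`-linear**: `φ(a^r) = φ(a)^r`, i.e. additively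
`φ(a^r) = r · φ(a)` — for EVERY monoid homomorphism `φ` (a degree map, say), since `r ↦ φ(a^r)` is additive in
`r`. [cite: MochizukiFrdI2008, Def. 2.4(ii) p.48] -/
theorem hom_nnreal_rpow (φ : h.Rlf →* Multiplicative ℝ≥0) (r : NNReal) (a : h.Rlf) :
    Multiplicative.toAdd (φ (rpow h r a)) = r * Multiplicative.toAdd (φ a) := by
  have hadd : ∀ s t : ℝ≥0, Multiplicative.toAdd (φ (rpow h (s + t) a)) =
      Multiplicative.toAdd (φ (rpow h s a)) + Multiplicative.toAdd (φ (rpow h t a)) := by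
    intro s t
    rw [rpow_add, map_mul, toAdd_mul]
  have := nnreal_map_eq_mul_of_map_add (fun s => Multiplicative.toAdd (φ (rpow h s a))) hadd r
  simpa only [rpow_one] using this

/-- The same, multiplicatively: `φ(a^r) = φ(a)^r` with the real power of `ℝ_{≥0}` written as
`ofAdd (r · toAdd _)`. [cite: MochizukiFrdI2008, Def. 2.4(ii) p.48] -/
theorem hom_nnreal_rpow' (φ : h.Rlf →* Multiplicative ℝ≥0) (r : NNReal) (a : h.Rlf) :
    φ (rpow h r a) = Multiplicative.ofAdd (r * Multiplicative.toAdd (φ a)) := by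
  rw [← hom_nnreal_rpow h φ r a, ofAdd_toAdd]

end IsPerfFactorial.Rlf

end Literature.AlgebraicGeometry.Frobenioids
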